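/-
Copyright (c) 2026 the pub-hodgecm-mathlib formalisation cell (harness21).  Prover seat hodgecm-mathlib-K2E5-p10 (g4), Track B «K2-LIT» ∕ h413
(`stmt-HodgeConjecture-24833`), line `K2_E3_EllipticInputs`, unit U12, §L road «U-iso-T» brick (G⁺-b)/(K4-E): BALLS OF REAL RADIUS, THE `‖v‖⁻²` TAIL,
ANISOTROPY OF A NON-SPLIT BINARY NORM FORM, and the ELLIPTIC bound `∫_F ‖a((σ−u)² − Δ)‖⁻¹ dσ ≤ 2 μ(𝒪) ∕ (‖2‖² ‖a‖ √‖Δ‖)` (`Δ ∉ F²`).  2026-09-04.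
-/
import Summits.HodgeConjecture.HodgeConjecture.Theorems.K2E3GL2BorelSliceKIntegral   -- ★ (this seat): `lintegral_normAbs_inv_sq_mul_comp_inv`; ★ Hensel `isSquare_of_normAbs_sub_lt`
import Literature.NumberTheory.Weil1964.LocalQuadraticGaussIntegral                -- ★ `normAbs_two_le_one`
import HarnessLib

/-!
# K2_E3 road (h413), §L brick (G⁺-b)/(K4-E) — real-radius balls, the `‖v‖⁻²` tail, anisotropy, the elliptic bound

Cell `pub/hodgecm-mathlib` (D-0151), Track B, seat K2E5-p10 (g4) (E3 §L line; §L lead K2E3-p12 (g4); (G⁺-b): line side K2E5-p17 (g3), `K`-side this seat).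
`--supports stmt-HodgeConjecture-24833 --as helper`; THEOREMS ONLY (no definition ∕ instance ∕ notation ∕ named fact ∕ `sorry`); never imports `Cruxes/…/Lines`.
COUNT-NEUTRAL.

The `K`-side of (G⁺-b) reduces (★ p857346 ∕ p857379) the unstable regular nilpotent Fourier transform to one-dimensional integrals
`∫ χ̃(P_X(σ)) ‖P_X(σ)‖⁻¹ 1[‖P_X(σ)‖ > q^{-2n}] dσ` of the cell quadratics `P_X` (discriminant `disc χ_X`).  This file is the ELLIPTIC case and the
general toolkit for the domination `≤ C · |disc χ_X|^{-1∕2}`: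
* §1 `exists_primePowBall_eq_setOf_normAbs_le` — every real-radius ball `{‖x‖ ≤ r}` (`r > 0`) is a `𝔭^m` with `(q⁻¹)^m ≤ r`; hence
  `μ{‖x‖ ≤ r} ≤ r·μ(𝒪)` and `μ{‖x‖ < r} ≤ r·μ(𝒪)` (`measure_setOf_normAbs_le_le`, `measure_setOf_normAbs_lt_le`);
* §2 `lintegral_normAbs_inv_sq_indicator_lt_le` — the tail `∫_{‖v‖ > R} ‖v‖⁻² dv ≤ R⁻¹ μ(𝒪)` (inversion `v = t⁻¹`, ★ `lintegral_normAbs_inv_sq_mul_comp_inv`);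
  `lintegral_inv_sq_max_le` — `∫_F (max(‖v − u‖, m))⁻² dv ≤ 2 m⁻¹ μ(𝒪)`;
* §3 (★ `Literature.NumberTheory.Weil1964.normAbs_two_le_one`) `normAbs_sq_sub_ge_of_not_isSquare` — ANISOTROPY: `‖v² − Δ‖ ≥ ‖2‖²·max(‖v‖², ‖Δ‖)` for `Δ ∉ F²` (Hensel, ★ `isSquare_of_normAbs_sub_lt`);
* §4 `lintegral_normAbs_inv_quadratic_le_of_not_isSquare` — the ELLIPTIC BOUND `∫_F ‖a((σ−u)² − Δ)‖⁻¹ dσ ≤ 2 ‖a‖⁻¹ ‖2‖⁻² (√‖Δ‖)⁻¹ μ(𝒪)`.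
[HarishChandra1999AdmissibleDistributions, §7] [LabesseLanglands1979, §2] [SerreLocalFields1979, Ch. XIV §4]
HONEST LABEL: HC_CM is proved only modulo the 7 printed citations (2 remaining named inputs: hLiu418 = stmt-HodgeConjecture-24832, h413 =
stmt-HodgeConjecture-24833) until rung 0 closes; count-neutral helper toward (LBU-2⁺)∕(G⁺-b), NOT ★.

## References
* [HarishChandra1999AdmissibleDistributions] Harish-Chandra (DeBacker–Sally), *Admissible Invariant Distributions on Reductive p-adic Groups* (1999), §7.
* [LabesseLanglands1979] J.-P. Labesse, R. P. Langlands, *L-indistinguishability for SL(2)*, Canad. J. Math. 31 (1979), §2.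
* [SerreLocalFields1979] J.-P. Serre, *Local Fields*, GTM 67 (1979), Ch. XIV §4.
-/

set_option autoImplicit false
set_option linter.dupNamespace false   -- `Summit.HodgeConjecture.HodgeConjecture.…` (D-0017 nested layout; lakefile exemption for Summits)

noncomputable section

open MeasureTheory Measure Filter Topology Set
open scoped NNReal ENNReal Pointwise
open ValuativeRel
open Literature.NumberTheory.Automorphic Literature.NumberTheory.Automorphic.LocalFieldHaar
open Literature.NumberTheory.GaloisRepresentations Literature.NumberTheory.GaloisRepresentations.IsNonarchimedeanLocalField
open Summit.HodgeConjecture.HodgeConjecture.Cruxes.H413.K2E3LocalFieldSquaresHensel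
open Summit.HodgeConjecture.HodgeConjecture.Cruxes.H413.K2E3GL2BorelSliceKIntegral

namespace Summit.HodgeConjecture.HodgeConjecture.Cruxes.H413.K2E3LocalFieldQuadraticWeightElliptic

variable {F : Type*} [Field F] [ValuativeRel F] [TopologicalSpace F] [IsNonarchimedeanLocalField F]

/-! ## §1  Balls of real radius -/

/-- **Every real-radius ball is a `𝔭^m`**: for `r > 0` there is `m ∈ ℤ` with `{x | ‖x‖ ≤ r} = 𝔭^m` and `(q⁻¹)^m ≤ r` (discreteness of `‖·‖_F`).
[cite: SerreLocalFields1979, Ch. II §1] -/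
theorem exists_primePowBall_eq_setOf_normAbs_le {r : ℝ≥0} (hr : 0 < r) :
    ∃ m : ℤ, {x : F | normAbs F x ≤ r} = primePowBall F m ∧ ((residueFieldCard F : ℝ≥0)⁻¹) ^ m ≤ r := by
  obtain ⟨n, hn1, hn2⟩ := exists_mem_Ico_zpow hr (one_lt_residueFieldCard_nnreal (F := F))
  refine ⟨-n, ?_, by rw [inv_zpow', neg_neg]; exact hn1⟩
  ext x
  simp only [mem_setOf_eq, primePowBall]
  constructor
  · intro hx
    have hlt : normAbs F x < ((residueFieldCard F : ℝ≥0)⁻¹) ^ (-n - 1) := by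
      rw [inv_zpow', neg_sub, sub_neg_eq_add, add_comm]; exact hx.trans_lt hn2
    have := normAbs_lt_zpow_iff.1 hlt
    rwa [sub_add_cancel] at this
  · intro hx
    refine hx.trans ?_
    rw [inv_zpow', neg_neg]; exact hn1

section Measure
variable [MeasurableSpace F] [BorelSpace F] (μ : Measure F) [μ.IsAddHaarMeasure]

/-- `μ(𝔭^m) = (q⁻¹)^m μ(𝒪)` in `ℝ≥0∞`. [cite: SerreLocalFields1979, Ch. II §1] -/
theorem measure_primePowBall_eq (m : ℤ) :
    μ (primePowBall F m) = ((((residueFieldCard F : ℝ≥0)⁻¹) ^ m : ℝ≥0) : ℝ≥0∞) * μ (primePowBall F 0) := by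
  have h1 : μ (primePowBall F m) ≠ ⊤ := (isCompact_primePowBall m).measure_lt_top.ne
  have h0 : μ (primePowBall F 0) ≠ ⊤ := (isCompact_primePowBall 0).measure_lt_top.ne
  rw [← ENNReal.ofReal_toReal h1, ← ENNReal.ofReal_toReal h0, ← measureReal_def, ← measureReal_def, measureReal_primePowBall,
    ENNReal.ofReal_mul (zpow_nonneg (inv_nonneg.2 (Nat.cast_nonneg _)) _)]
  congr 1
  rw [← NNReal.coe_natCast, ← NNReal.coe_inv, ← NNReal.coe_zpow, ENNReal.ofReal_coe_nnreal]

/-- **`μ{‖x‖ ≤ r} ≤ r·μ(𝒪)`** for `r > 0`. [cite: SerreLocalFields1979, Ch. II §1] -/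
theorem measure_setOf_normAbs_le_le {r : ℝ≥0} (hr : 0 < r) :
    μ {x : F | normAbs F x ≤ r} ≤ (r : ℝ≥0∞) * μ (primePowBall F 0) := by
  obtain ⟨m, hm, hmr⟩ := exists_primePowBall_eq_setOf_normAbs_le (F := F) hr
  rw [hm, measure_primePowBall_eq]
  exact mul_le_mul_of_nonneg_right (ENNReal.coe_le_coe.2 hmr) bot_le

/-- **`μ{‖x‖ < r} ≤ r·μ(𝒪)`** for `r > 0`. [cite: SerreLocalFields1979, Ch. II §1] -/
theorem measure_setOf_normAbs_lt_le {r : ℝ≥0} (hr : 0 < r) :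
    μ {x : F | normAbs F x < r} ≤ (r : ℝ≥0∞) * μ (primePowBall F 0) :=
  (measure_mono (fun x (hx : normAbs F x < r) => hx.le)).trans (measure_setOf_normAbs_le_le μ hr)

/-! ## §2  The `‖v‖⁻²` tail and `∫ (max(‖v−u‖, m))⁻²` -/

/-- **The tail `∫_{‖v‖ > R} ‖v‖⁻² dv ≤ R⁻¹ μ(𝒪)`** (`R > 0`): by the inversion `v = t⁻¹` (★ `lintegral_normAbs_inv_sq_mul_comp_inv`) the tail is
`μ{‖t‖ < R⁻¹}`. [cite: SerreLocalFields1979, Ch. XIV §4] -/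
theorem lintegral_normAbs_inv_sq_indicator_lt_le {R : ℝ≥0} (hR : 0 < R) :
    ∫⁻ v, {v : F | R < normAbs F v}.indicator (fun v => ((((normAbs F v)⁻¹) ^ 2 : ℝ≥0) : ℝ≥0∞)) v ∂μ ≤ ((R⁻¹ : ℝ≥0) : ℝ≥0∞) * μ (primePowBall F 0) := by
  have hmeas : MeasurableSet {t : F | normAbs F t < R⁻¹} := measurableSet_lt measurable_normAbs measurable_const
  have hH : Measurable ({t : F | normAbs F t < R⁻¹}.indicator (1 : F → ℝ≥0∞)) := measurable_one.indicator hmeas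
  have key : ∀ v : F, {v : F | R < normAbs F v}.indicator (fun v => ((((normAbs F v)⁻¹) ^ 2 : ℝ≥0) : ℝ≥0∞)) v =
      ((((normAbs F v)⁻¹) ^ 2 : ℝ≥0) : ℝ≥0∞) * {t : F | normAbs F t < R⁻¹}.indicator (1 : F → ℝ≥0∞) v⁻¹ := by
    intro v
    by_cases hv : R < normAbs F v
    · have hmem : v⁻¹ ∈ {t : F | normAbs F t < R⁻¹} := by
        simp only [mem_setOf_eq, map_inv₀]; exact NNReal.inv_lt_inv hR.ne' hv
      rw [indicator_of_mem (show v ∈ {v : F | R < normAbs F v} from hv), indicator_of_mem hmem, Pi.one_apply, mul_one]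
    · rw [indicator_of_notMem (show v ∉ {v : F | R < normAbs F v} from hv)]
      by_cases hv0 : v = 0
      · simp [hv0]
      · have hvpos : 0 < normAbs F v := pos_iff_ne_zero.2 ((map_ne_zero (normAbs F)).2 hv0)
        have hnmem : v⁻¹ ∉ {t : F | normAbs F t < R⁻¹} := by
          simp only [mem_setOf_eq, map_inv₀, not_lt]
          exact (inv_le_inv₀ hR hvpos).2 (not_lt.1 hv)
        rw [indicator_of_notMem hnmem, mul_zero]
  simp_rw [key]
  rw [lintegral_normAbs_inv_sq_mul_comp_inv μ _ hH, lintegral_indicator_one hmeas]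
  exact measure_setOf_normAbs_lt_le μ (inv_pos.2 hR)

/-- **`∫_F (max(‖v − u‖, m))⁻² dv ≤ 2 m⁻¹ μ(𝒪)`** (`m > 0`): the ball `{‖v−u‖ ≤ m}` contributes `m⁻²·μ{‖w‖ ≤ m} ≤ m⁻¹μ(𝒪)` (§1) and the
tail `∫_{‖w‖ > m} ‖w‖⁻² ≤ m⁻¹ μ(𝒪)` (§2). [cite: SerreLocalFields1979, Ch. XIV §4] -/
theorem lintegral_inv_sq_max_le (u : F) {m : ℝ≥0} (hm : 0 < m) :
    ∫⁻ v, ((((max (normAbs F (v - u)) m)⁻¹) ^ 2 : ℝ≥0) : ℝ≥0∞) ∂μ ≤ 2 * ((m⁻¹ : ℝ≥0) : ℝ≥0∞) * μ (primePowBall F 0) := by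
  have hshift : ∫⁻ v, ((((max (normAbs F (v - u)) m)⁻¹) ^ 2 : ℝ≥0) : ℝ≥0∞) ∂μ = ∫⁻ w, ((((max (normAbs F w) m)⁻¹) ^ 2 : ℝ≥0) : ℝ≥0∞) ∂μ := by
    simp_rw [sub_eq_neg_add]
    exact lintegral_add_left_eq_self (μ := μ) (fun w => ((((max (normAbs F w) m)⁻¹) ^ 2 : ℝ≥0) : ℝ≥0∞)) (-u)
  rw [hshift]
  have hA : MeasurableSet {w : F | normAbs F w ≤ m} := measurableSet_le measurable_normAbs measurable_const
  have hB : MeasurableSet {w : F | m < normAbs F w} := measurableSet_lt measurable_const measurable_normAbs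
  have hpt : ∀ w : F, ((((max (normAbs F w) m)⁻¹) ^ 2 : ℝ≥0) : ℝ≥0∞) ≤
      (((m⁻¹) ^ 2 : ℝ≥0) : ℝ≥0∞) * {w : F | normAbs F w ≤ m}.indicator (1 : F → ℝ≥0∞) w +
        {w : F | m < normAbs F w}.indicator (fun w => ((((normAbs F w)⁻¹) ^ 2 : ℝ≥0) : ℝ≥0∞)) w := by
    intro w
    by_cases hw : normAbs F w ≤ m
    · rw [max_eq_right hw, indicator_of_mem (show w ∈ {w : F | normAbs F w ≤ m} from hw), Pi.one_apply, mul_one]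
      exact le_self_add
    · rw [max_eq_left (not_le.1 hw).le, indicator_of_mem (show w ∈ {w : F | m < normAbs F w} from not_le.1 hw)]
      exact le_add_self
  calc ∫⁻ w, ((((max (normAbs F w) m)⁻¹) ^ 2 : ℝ≥0) : ℝ≥0∞) ∂μ
      ≤ ∫⁻ w, (((m⁻¹) ^ 2 : ℝ≥0) : ℝ≥0∞) * {w : F | normAbs F w ≤ m}.indicator (1 : F → ℝ≥0∞) w +
          {w : F | m < normAbs F w}.indicator (fun w => ((((normAbs F w)⁻¹) ^ 2 : ℝ≥0) : ℝ≥0∞)) w ∂μ := lintegral_mono hpt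
    _ = (((m⁻¹) ^ 2 : ℝ≥0) : ℝ≥0∞) * μ {w : F | normAbs F w ≤ m} +
          ∫⁻ w, {w : F | m < normAbs F w}.indicator (fun w => ((((normAbs F w)⁻¹) ^ 2 : ℝ≥0) : ℝ≥0∞)) w ∂μ := by
        rw [lintegral_add_left ((measurable_one.indicator hA).const_mul _), lintegral_const_mul _ (measurable_one.indicator hA),
          lintegral_indicator_one hA]
    _ ≤ (((m⁻¹) ^ 2 : ℝ≥0) : ℝ≥0∞) * ((m : ℝ≥0∞) * μ (primePowBall F 0)) + ((m⁻¹ : ℝ≥0) : ℝ≥0∞) * μ (primePowBall F 0) := by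
        gcongr
        · exact measure_setOf_normAbs_le_le μ hm
        · exact lintegral_normAbs_inv_sq_indicator_lt_le μ hm
    _ = 2 * ((m⁻¹ : ℝ≥0) : ℝ≥0∞) * μ (primePowBall F 0) := by
        rw [← mul_assoc, ← ENNReal.coe_mul, show (m⁻¹) ^ 2 * m = m⁻¹ by rw [pow_two, mul_assoc, inv_mul_cancel₀ hm.ne', mul_one]]
        ring

end Measure

/-! ## §3  Anisotropy of a non-split binary norm form -/

/-- **ANISOTROPY**: if `Δ ∈ F` is NOT a square then `‖v² − Δ‖ ≥ ‖2‖² · max(‖v‖², ‖Δ‖)` for every `v ∈ F` (`char F ≠ 2`).  If `‖v²‖ ≠ ‖Δ‖` the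
ultrametric inequality gives `‖v² − Δ‖ = max`; if `‖v²‖ = ‖Δ‖` and `‖Δ − v²‖ < ‖2‖²‖v²‖`, Hensel (★ `isSquare_of_normAbs_sub_lt`) would make `Δ` a square.
[cite: SerreLocalFields1979, Ch. XIV §4] -/
theorem normAbs_sq_sub_ge_of_not_isSquare (h2 : (2 : F) ≠ 0) {Δ : F} (hΔ : ¬ IsSquare Δ) (v : F) :
    normAbs F 2 ^ 2 * max (normAbs F v ^ 2) (normAbs F Δ) ≤ normAbs F (v ^ 2 - Δ) := by
  have h21 : normAbs F (2 : F) ^ 2 ≤ 1 := pow_le_one₀ (by positivity) Literature.NumberTheory.Weil1964.normAbs_two_le_one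
  rcases lt_trichotomy (normAbs F v ^ 2) (normAbs F Δ) with hlt | heq | hgt
  · -- `‖v²‖ < ‖Δ‖`
    have h : normAbs F (v ^ 2 - Δ) = normAbs F Δ := by
      rw [sub_eq_neg_add, ← normAbs_neg Δ]
      refine normAbs_add_eq_of_lt ?_
      rwa [normAbs_neg, map_pow]
    rw [h, max_eq_right hlt.le]
    exact mul_le_of_le_one_left (by positivity) h21
  · -- `‖v²‖ = ‖Δ‖`: Hensel
    rw [heq, max_self]
    by_contra hcon
    rw [not_le] at hcon
    have hv0 : v ^ 2 ≠ 0 := by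
      intro hv
      have : normAbs F Δ = 0 := by rw [← heq, ← map_pow, hv, map_zero]
      exact hΔ (by rw [(map_eq_zero (normAbs F)).1 this]; exact ⟨0, by ring⟩)
    refine hΔ (isSquare_of_normAbs_sub_lt h2 ⟨v, by ring⟩ hv0 ?_)
    rw [← neg_sub, normAbs_neg, map_pow, heq]
    exact hcon
  · -- `‖Δ‖ < ‖v²‖`
    have h : normAbs F (v ^ 2 - Δ) = normAbs F v ^ 2 := by
      rw [sub_eq_add_neg, ← map_pow]
      refine normAbs_add_eq_of_lt ?_
      rwa [normAbs_neg, map_pow]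
    rw [h, max_eq_left hgt.le]
    exact mul_le_of_le_one_left (by positivity) h21

/-! ## §4  The elliptic bound -/

section Elliptic
variable [MeasurableSpace F] [BorelSpace F] (μ : Measure F) [μ.IsAddHaarMeasure]

omit [MeasurableSpace F] [BorelSpace F] in
/-- Pointwise: `‖a((σ−u)² − Δ)‖⁻¹ ≤ ‖a‖⁻¹ ‖2‖⁻² (max(‖σ−u‖, √‖Δ‖))⁻²` for `Δ ∉ F²`, `a ≠ 0`. [cite: SerreLocalFields1979, Ch. XIV §4] -/
theorem normAbs_inv_quadratic_le_of_not_isSquare (h2 : (2 : F) ≠ 0) {a Δ : F} (ha : a ≠ 0) (hΔ : ¬ IsSquare Δ) (u σ : F) :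
    (normAbs F (a * ((σ - u) ^ 2 - Δ)))⁻¹ ≤
      (normAbs F a)⁻¹ * ((normAbs F 2)⁻¹) ^ 2 * ((max (normAbs F (σ - u)) (NNReal.sqrt (normAbs F Δ)))⁻¹) ^ 2 := by
  have hΔ0 : Δ ≠ 0 := by rintro rfl; exact hΔ ⟨0, by ring⟩
  have hΔpos : 0 < normAbs F Δ := pos_iff_ne_zero.2 ((map_ne_zero (normAbs F)).2 hΔ0)
  have ha0 : 0 < normAbs F a := pos_iff_ne_zero.2 ((map_ne_zero (normAbs F)).2 ha)
  have h20 : 0 < normAbs F (2 : F) := pos_iff_ne_zero.2 ((map_ne_zero (normAbs F)).2 h2)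
  have hmax : max (normAbs F (σ - u) ^ 2) (normAbs F Δ) = (max (normAbs F (σ - u)) (NNReal.sqrt (normAbs F Δ))) ^ 2 := by
    conv_lhs => rw [← NNReal.sq_sqrt (normAbs F Δ)]
    rcases le_total (normAbs F (σ - u)) (NNReal.sqrt (normAbs F Δ)) with h | h
    · rw [max_eq_right h, max_eq_right (pow_le_pow_left₀ (by positivity) h 2)]
    · rw [max_eq_left h, max_eq_left (pow_le_pow_left₀ (by positivity) h 2)]
  have hMpos : 0 < max (normAbs F (σ - u)) (NNReal.sqrt (normAbs F Δ)) := lt_max_of_lt_right (NNReal.sqrt_pos.2 hΔpos)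
  have hani := normAbs_sq_sub_ge_of_not_isSquare h2 hΔ (σ - u)
  rw [hmax] at hani
  have hlow : normAbs F a * (normAbs F 2 ^ 2 * (max (normAbs F (σ - u)) (NNReal.sqrt (normAbs F Δ))) ^ 2) ≤ normAbs F (a * ((σ - u) ^ 2 - Δ)) := by
    rw [map_mul]; exact mul_le_mul_of_nonneg_left hani (by positivity)
  have hpos : 0 < normAbs F a * (normAbs F 2 ^ 2 * (max (normAbs F (σ - u)) (NNReal.sqrt (normAbs F Δ))) ^ 2) := by positivity
  calc (normAbs F (a * ((σ - u) ^ 2 - Δ)))⁻¹ ≤ (normAbs F a * (normAbs F 2 ^ 2 * (max (normAbs F (σ - u)) (NNReal.sqrt (normAbs F Δ))) ^ 2))⁻¹ :=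
        inv_anti₀ hpos hlow
    _ = (normAbs F a)⁻¹ * ((normAbs F 2)⁻¹) ^ 2 * ((max (normAbs F (σ - u)) (NNReal.sqrt (normAbs F Δ)))⁻¹) ^ 2 := by
        rw [mul_inv, mul_inv, inv_pow, inv_pow, mul_assoc]

/-- **THE ELLIPTIC BOUND.**  If `Δ ∈ F` is not a square, `a ≠ 0`, `u ∈ F` (`char F ≠ 2`), then
`∫_F ‖a((σ − u)² − Δ)‖⁻¹ dμ(σ) ≤ 2 ‖a‖⁻¹ ‖2‖⁻² (√‖Δ‖)⁻¹ μ(𝒪)`; for the cell quadratic `P_X(σ) = −X₀₁((σ−u)² − Δ)` with `Δ = disc χ_X ∕ (4X₀₁²)`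
a non-square (ELLIPTIC `X`) this is `≤ 2 ‖2‖⁻¹ μ(𝒪) · |disc χ_X|^{-1∕2}`. [cite: HarishChandra1999AdmissibleDistributions, §7] [cite: LabesseLanglands1979, §2] -/
theorem lintegral_normAbs_inv_quadratic_le_of_not_isSquare (h2 : (2 : F) ≠ 0) {a Δ : F} (ha : a ≠ 0) (hΔ : ¬ IsSquare Δ) (u : F) :
    ∫⁻ σ, (((normAbs F (a * ((σ - u) ^ 2 - Δ)))⁻¹ : ℝ≥0) : ℝ≥0∞) ∂μ ≤
      2 * (((normAbs F a)⁻¹ * ((normAbs F 2)⁻¹) ^ 2 * (NNReal.sqrt (normAbs F Δ))⁻¹ : ℝ≥0) : ℝ≥0∞) * μ (primePowBall F 0) := by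
  have hΔ0 : Δ ≠ 0 := by rintro rfl; exact hΔ ⟨0, by ring⟩
  have hΔpos : 0 < NNReal.sqrt (normAbs F Δ) := NNReal.sqrt_pos.2 (pos_iff_ne_zero.2 ((map_ne_zero (normAbs F)).2 hΔ0))
  calc ∫⁻ σ, (((normAbs F (a * ((σ - u) ^ 2 - Δ)))⁻¹ : ℝ≥0) : ℝ≥0∞) ∂μ
      ≤ ∫⁻ σ, (((normAbs F a)⁻¹ * ((normAbs F 2)⁻¹) ^ 2 : ℝ≥0) : ℝ≥0∞) *
          ((((max (normAbs F (σ - u)) (NNReal.sqrt (normAbs F Δ)))⁻¹) ^ 2 : ℝ≥0) : ℝ≥0∞) ∂μ := by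
        refine lintegral_mono fun σ => ?_
        rw [← ENNReal.coe_mul]
        exact ENNReal.coe_le_coe.2 (normAbs_inv_quadratic_le_of_not_isSquare h2 ha hΔ u σ)
    _ = (((normAbs F a)⁻¹ * ((normAbs F 2)⁻¹) ^ 2 : ℝ≥0) : ℝ≥0∞) *
          ∫⁻ σ, ((((max (normAbs F (σ - u)) (NNReal.sqrt (normAbs F Δ)))⁻¹) ^ 2 : ℝ≥0) : ℝ≥0∞) ∂μ := by
        rw [lintegral_const_mul']
        exact ENNReal.coe_ne_top
    _ ≤ (((normAbs F a)⁻¹ * ((normAbs F 2)⁻¹) ^ 2 : ℝ≥0) : ℝ≥0∞) * (2 * (((NNReal.sqrt (normAbs F Δ))⁻¹ : ℝ≥0) : ℝ≥0∞) * μ (primePowBall F 0)) :=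
        mul_le_mul_of_nonneg_left (lintegral_inv_sq_max_le μ u hΔpos) bot_le
    _ = 2 * (((normAbs F a)⁻¹ * ((normAbs F 2)⁻¹) ^ 2 * (NNReal.sqrt (normAbs F Δ))⁻¹ : ℝ≥0) : ℝ≥0∞) * μ (primePowBall F 0) := by
        push_cast
        ring

end Elliptic

end Summit.HodgeConjecture.HodgeConjecture.Cruxes.H413.K2E3LocalFieldQuadraticWeightElliptic

end
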